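import Mathlib
import Summits.NavierStokesRegularity.NavierStokesRegularity.Theorems.FilamentSkeletonRssSelectionBoxRJRungCutoffShooting

/-!
# Route `FilamentSkeletonRss` · crux `SelectionBoxRJ` (stmt-NavierStokesRegularity-21220) — rung tools (R2, brick 3a):
# cut-off shooting with a merely CONTINUOUS frozen forcing

Lane `ns-filament-19175-p1` (g7); helper file `--supports stmt-NavierStokesRegularity-21220`, route-independent.

`…RungCutoffShooting` (p583319) solves `X″ = B X′ (g t X)` globally for `g` jointly `C¹`.  The Picard step of the nonlocal
rung R2 freezes the TRUE partner field along the previous iterate, `f(t) = u[R_π z](z t)`, which is differentiable but not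
known to be `C¹`; so this file re-runs the same phase-space argument under the two properties it actually uses —
Lipschitz on balls uniformly on compact time intervals, and joint continuity — and specialises to the affine-in-`x`
field `g t x = c t • (A x + U t)` with `c`, `U` merely CONTINUOUS (`A` continuous linear):

* `CutoffShooting.exists_forward_of_lip`, `exists_phase_of_lip`, `unique_of_phase_of_lip` — the abstract versions;
* `lipschitz_affine_field` — `(t, (x, w)) ↦ (w, B w (c t • (A x + U t)))` is Lipschitz on balls uniformly for `t` in a
  compact interval when `c, U` are continuous (the parameters `(c t, U t)` range in a compact set on which the `C¹` map
  `((x, w), (s, u)) ↦ (w, B w (s • (A x + u)))` has bounded derivative);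
* `cutoffLia_exists_cont` / `cutoffLia_unique_cont` — global `C²` unit-speed solution of
  `X″ t = c t • X′ t × (A (X t) + U t)` on `ℝ³` for continuous `c`, `U`, unique for given Cauchy data.

HONEST FRAMING.  ODE bookkeeping for the rung ladder of a HYPOTHETICAL filament box; nothing here is a claim about
Navier–Stokes regularity or blow-up.
-/

set_option linter.dupNamespace false -- `Theorems.…Theorems`-style path/namespace repetition is the tree convention

noncomputable section

namespace Summit.NavierStokesRegularity.NavierStokesRegularity.Theorems

open Set Metric Filter Topology Function
open Literature.Analysis.FluidPDE Literature.Analysis.ODE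
open scoped RealInnerProductSpace InnerProductSpace NNReal

namespace SelectionBoxRJRung

namespace CutoffShooting

variable {F : Type*} [NormedAddCommGroup F] [InnerProductSpace ℝ F]

/-- **Forward global existence under abstract hypotheses**: Lipschitz on balls uniformly on compact time intervals and
joint continuity of `g` suffice (same proof as `exists_forward`). [folklore] -/
theorem exists_forward_of_lip [ProperSpace F] {B : F →L[ℝ] F →L[ℝ] F}
    (hB : ∀ w v, ⟪B w v, w⟫ = 0) {g : ℝ → F → F}
    (hL : ∀ T ρ : ℝ, ∃ K : ℝ≥0, ∀ t ∈ Icc (-T) T,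
      LipschitzOnWith K (fun p : F × F => (p.2, B p.2 (g t p.1))) (closedBall 0 ρ))
    (hgc : Continuous (fun q : ℝ × F => g q.1 q.2)) (P : F) {e : F} (he : ‖e‖ = 1) :
    ∃ γ : ℝ → F × F, γ 0 = (P, e) ∧ ∀ T, ∀ t ∈ Icc 0 T,
      HasDerivWithinAt γ ((γ t).2, B (γ t).2 (g t (γ t).1)) (Icc 0 T) t := by
  refine exists_solution_of_apriori_bound
    (v := fun t (p : F × F) => (p.2, B p.2 (g t p.1))) ?_ ?_ ?_
  · intro T ρ
    obtain ⟨K, hK⟩ := hL T ρ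
    exact ⟨K, fun t ht => hK t ⟨by linarith [ht.1, ht.2], ht.2⟩⟩
  · intro p
    have : Continuous fun t : ℝ => g t p.1 := hgc.comp (by fun_prop : Continuous fun t : ℝ => (t, p.1))
    exact (continuous_const.prodMk ((B p.2).continuous.comp this)).continuousOn
  · intro T hT
    refine ⟨‖P‖ + T + 1, ?_, fun s hs γ h0 hγ t ht => ?_⟩
    · rw [Prod.norm_mk, he]
      exact max_le (by linarith) (by linarith [norm_nonneg P])
    · obtain ⟨hw, hx⟩ := apriori hB he h0 hγ t ht
      rw [Prod.norm_def, hw]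
      exact max_le (by linarith [ht.2, hs.2]) (by linarith [norm_nonneg P])

/-- **Two-sided global phase curve under abstract hypotheses** (forward solution and reversed forward solution of the
reversed system glued at `0`). [folklore] -/
theorem exists_phase_of_lip [ProperSpace F] {B : F →L[ℝ] F →L[ℝ] F}
    (hB : ∀ w v, ⟪B w v, w⟫ = 0) {g : ℝ → F → F}
    (hL : ∀ T ρ : ℝ, ∃ K : ℝ≥0, ∀ t ∈ Icc (-T) T,
      LipschitzOnWith K (fun p : F × F => (p.2, B p.2 (g t p.1))) (closedBall 0 ρ))
    (hgc : Continuous (fun q : ℝ × F => g q.1 q.2)) (P : F) {e : F} (he : ‖e‖ = 1) :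
    ∃ γ : ℝ → F × F, γ 0 = (P, e) ∧ (∀ t, ‖(γ t).2‖ = 1) ∧
      ∀ t, HasDerivAt γ ((γ t).2, B (γ t).2 (g t (γ t).1)) t := by
  obtain ⟨α, hα0, hα⟩ := exists_forward_of_lip hB hL hgc P he
  have he' : ‖-e‖ = 1 := by rw [norm_neg, he]
  have hB' : ∀ w v, ⟪(-B) w v, w⟫ = 0 := fun w v => by
    rw [_root_.neg_apply, _root_.neg_apply, inner_neg_left, hB, neg_zero]
  have hgc' : Continuous (fun q : ℝ × F => g (-q.1) q.2) :=
    hgc.comp (by fun_prop : Continuous (fun q : ℝ × F => (-q.1, q.2)))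
  have hL' : ∀ T ρ : ℝ, ∃ K : ℝ≥0, ∀ t ∈ Icc (-T) T,
      LipschitzOnWith K (fun p : F × F => (p.2, (-B) p.2 (g (-t) p.1))) (closedBall 0 ρ) := by
    intro T ρ
    obtain ⟨K, hK⟩ := hL T ρ
    refine ⟨K, fun t ht => ?_⟩
    have hmt : -t ∈ Icc (-T) T := ⟨by linarith [ht.2], by linarith [ht.1]⟩
    have h := hK (-t) hmt
    -- `(w, (-B) w v) = L (w, B w v)` with the isometry `L (a, b) = (a, -b)`
    refine LipschitzOnWith.of_dist_le_mul fun p hp q hq => ?_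
    have h1 := h.dist_le_mul p hp q hq
    rw [Prod.dist_eq] at h1 ⊢
    simp only [_root_.neg_apply, dist_neg_neg] at h1 ⊢
    exact h1
  obtain ⟨β, hβ0, hβ⟩ := exists_forward_of_lip hB' (g := fun t x => g (-t) x) hL' hgc' P he'
  set βr : ℝ → F × F := fun s => ((β (-s)).1, -(β (-s)).2) with hβr
  refine ⟨fun s => if s ≤ 0 then βr s else α s, by simp [hβr, hβ0], fun t => ?_, fun t => ?_⟩
  · by_cases ht : t ≤ 0
    · simp only [if_pos ht, hβr, norm_neg]
      exact ((apriori hB' he' hβ0 (hβ (-t))) (-t) ⟨neg_nonneg.2 ht, le_rfl⟩).1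
    · simp only [if_neg ht]
      exact ((apriori hB he hα0 (hα t)) t ⟨(not_le.1 ht).le, le_rfl⟩).1
  · have hT : 0 < |t| + 1 := by positivity
    have hsol := solution_append (v := fun t (p : F × F) => (p.2, B p.2 (g t p.1)))
      (reverse (hβ (|t| + 1))) (hα (|t| + 1)) (by linarith) hT.le (by simp [hβ0, hα0])
    exact solution_hasDerivAt (v := fun t (p : F × F) => (p.2, B p.2 (g t p.1))) hsol
      ⟨by linarith [neg_abs_le t], by linarith [le_abs_self t]⟩

/-- **Uniqueness under abstract hypotheses** (Grönwall on the phase curves). [folklore] -/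
theorem unique_of_phase_of_lip [ProperSpace F] {B : F →L[ℝ] F →L[ℝ] F} {g : ℝ → F → F}
    (hL : ∀ T ρ : ℝ, ∃ K : ℝ≥0, ∀ t ∈ Icc (-T) T,
      LipschitzOnWith K (fun p : F × F => (p.2, B p.2 (g t p.1))) (closedBall 0 ρ))
    {X Y : ℝ → F} (hX : ContDiff ℝ 2 X) (hY : ContDiff ℝ 2 Y)
    (h0 : X 0 = Y 0) (h0' : deriv X 0 = deriv Y 0)
    (hXo : ∀ t, deriv (deriv X) t = B (deriv X t) (g t (X t)))
    (hYo : ∀ t, deriv (deriv Y) t = B (deriv Y t) (g t (Y t))) : X = Y := by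
  have key : ∀ {Z : ℝ → F}, ContDiff ℝ 2 Z →
      (∀ t, deriv (deriv Z) t = B (deriv Z t) (g t (Z t))) →
      (Continuous fun s => (Z s, deriv Z s)) ∧
      ∀ t, HasDerivAt (fun s => (Z s, deriv Z s)) (deriv Z t, B (deriv Z t) (g t (Z t))) t := by
    intro Z hZ hZo
    have hd : Differentiable ℝ Z := hZ.differentiable two_ne_zero
    have hd2 : Differentiable ℝ (deriv Z) := hZ.differentiable_deriv_two
    exact ⟨hd.continuous.prodMk hd2.continuous, fun t =>
      ((hd t).hasDerivAt.prodMk (hd2 t).hasDerivAt).congr_deriv (by rw [hZo t])⟩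
  obtain ⟨hXc, hXd⟩ := key hX hXo
  obtain ⟨hYc, hYd⟩ := key hY hYo
  funext t
  have hT0 : (0 : ℝ) ∈ Ioo (-(|t| + 1)) (|t| + 1) := ⟨by linarith [abs_nonneg t], by positivity⟩
  have htT : t ∈ Ioo (-(|t| + 1)) (|t| + 1) :=
    ⟨by linarith [neg_abs_le t], by linarith [le_abs_self t]⟩
  obtain ⟨ρ₁, hρ₁⟩ := isCompact_Icc.exists_bound_of_continuousOn
    (hXc.continuousOn (s := Icc (-(|t| + 1)) (|t| + 1)))
  obtain ⟨ρ₂, hρ₂⟩ := isCompact_Icc.exists_bound_of_continuousOn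
    (hYc.continuousOn (s := Icc (-(|t| + 1)) (|t| + 1)))
  obtain ⟨K, hK⟩ := hL (|t| + 1) (max ρ₁ ρ₂)
  have h := ODE_solution_unique_of_mem_Ioo
    (v := fun t (p : F × F) => (p.2, B p.2 (g t p.1)))
    (s := fun _ => closedBall 0 (max ρ₁ ρ₂))
    (fun τ hτ => hK τ (Ioo_subset_Icc_self hτ)) hT0
    (fun τ hτ => ⟨hXd τ, mem_closedBall_zero_iff.2
      ((hρ₁ τ (Ioo_subset_Icc_self hτ)).trans (le_max_left _ _))⟩)
    (fun τ hτ => ⟨hYd τ, mem_closedBall_zero_iff.2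
      ((hρ₂ τ (Ioo_subset_Icc_self hτ)).trans (le_max_right _ _))⟩)
    (by simp only [h0, h0']) htT
  exact congrArg Prod.fst h

/-- **The affine-in-`x` field with continuous coefficients is Lipschitz on balls, uniformly on compact time intervals.**
For `B` continuous bilinear, `A` continuous linear, `c : ℝ → ℝ` and `U : ℝ → F` continuous: the map
`((x, w), (s, u)) ↦ (w, B w (s • (A x + u)))` is `C¹`, so it is Lipschitz on the compact convex set
`B̄(0, ρ) × B̄(0, M)`; for `t ∈ [−T, T]` the parameters `(c t, U t)` lie in `B̄(0, M)`. [folklore] -/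
theorem lipschitz_affine_field [ProperSpace F] (B : F →L[ℝ] F →L[ℝ] F) (A : F →L[ℝ] F) {c : ℝ → ℝ} {U : ℝ → F}
    (hc : Continuous c) (hU : Continuous U) (T ρ : ℝ) :
    ∃ K : ℝ≥0, ∀ t ∈ Icc (-T) T,
      LipschitzOnWith K (fun p : F × F => (p.2, B p.2 (c t • (A p.1 + U t)))) (closedBall 0 ρ) := by
  -- a common bound for the parameters on `[−T, T]`
  obtain ⟨M₁, hM₁⟩ := isCompact_Icc.exists_bound_of_continuousOn (hc.continuousOn (s := Icc (-T) T))
  obtain ⟨M₂, hM₂⟩ := isCompact_Icc.exists_bound_of_continuousOn (hU.continuousOn (s := Icc (-T) T))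
  have hΦ : ContDiff ℝ 1 (fun q : (F × F) × (ℝ × F) => (q.1.2, B q.1.2 (q.2.1 • (A q.1.1 + q.2.2)))) := by
    refine ContDiff.prodMk (by fun_prop) ?_
    exact (B.contDiff.comp (by fun_prop : ContDiff ℝ 1 (fun q : (F × F) × (ℝ × F) => q.1.2))).clm_apply
      (by fun_prop)
  have hS : IsCompact (closedBall (0 : F × F) ρ ×ˢ closedBall (0 : ℝ × F) (max M₁ M₂)) :=
    (isCompact_closedBall _ _).prod (isCompact_closedBall _ _)
  obtain ⟨C, hC⟩ := hS.exists_bound_of_continuousOn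
    (hΦ.continuous_fderiv one_ne_zero).continuousOn
  have hLip := Convex.lipschitzOnWith_of_nnnorm_fderiv_le (𝕜 := ℝ) (C := Real.toNNReal C)
    (fun q _ => hΦ.differentiable one_ne_zero q)
    (fun q hq => by
      rw [← NNReal.coe_le_coe, coe_nnnorm]
      exact (hC q hq).trans (Real.le_coe_toNNReal C))
    ((convex_closedBall _ _).prod (convex_closedBall _ _))
  refine ⟨Real.toNNReal C, fun t ht => LipschitzOnWith.of_dist_le_mul fun p hp q hq => ?_⟩
  have hpar : (c t, U t) ∈ closedBall (0 : ℝ × F) (max M₁ M₂) := by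
    rw [mem_closedBall_zero_iff, Prod.norm_def]
    exact max_le ((hM₁ t ht).trans (le_max_left _ _)) ((hM₂ t ht).trans (le_max_right _ _))
  have h := hLip.dist_le_mul (p, (c t, U t)) ⟨hp, hpar⟩ (q, (c t, U t)) ⟨hq, hpar⟩
  rwa [@Prod.dist_eq _ _ _ _ (p, (c t, U t)) (q, (c t, U t)), dist_self, max_eq_left dist_nonneg] at h

end CutoffShooting

open CutoffShooting in
/-- **The cut-off local-induction equation on `ℝ³` with CONTINUOUS coefficients (existence).**  For continuous
`c : ℝ → ℝ`, `U : ℝ → ℝ³`, a continuous linear `A : ℝ³ → ℝ³` and Cauchy data `(P, e)`, `‖e‖ = 1`, there is a global `C²`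
unit-speed curve `X` with `X 0 = P`, `X′ 0 = e` and `X″ t = c t • X′ t × (A (X t) + U t)` for all `t`. [folklore] -/
theorem cutoffLia_exists_cont {c : ℝ → ℝ} {U : ℝ → EuclideanSpace ℝ (Fin 3)} (hc : Continuous c) (hU : Continuous U)
    (A : EuclideanSpace ℝ (Fin 3) →L[ℝ] EuclideanSpace ℝ (Fin 3))
    (P : EuclideanSpace ℝ (Fin 3)) {e : EuclideanSpace ℝ (Fin 3)} (he : ‖e‖ = 1) :
    ∃ X : ℝ → EuclideanSpace ℝ (Fin 3), ContDiff ℝ 2 X ∧ X 0 = P ∧ deriv X 0 = e ∧ (∀ t, ‖deriv X t‖ = 1) ∧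
      ∀ t, iteratedDeriv 2 X t = c t • cross (deriv X t) (A (X t) + U t) := by
  have hB : ∀ w v : EuclideanSpace ℝ (Fin 3), ⟪crossCLM w v, w⟫ = 0 := fun w v => by
    simp only [crossCLM_apply, cross, PiLp.inner_apply, RCLike.inner_apply, conj_trivial, Fin.sum_univ_three,
      crossProduct, LinearMap.mk₂_apply, Matrix.cons_val_zero, Matrix.cons_val_one,
      Matrix.cons_val_two, Matrix.head_cons, Matrix.tail_cons]
    ring
  have hL := lipschitz_affine_field crossCLM A hc hU
  have hgc : Continuous (fun q : ℝ × EuclideanSpace ℝ (Fin 3) => c q.1 • (A q.2 + U q.1)) := by fun_prop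
  obtain ⟨γ, h0, hunit, hγ⟩ := exists_phase_of_lip hB (g := fun t y => c t • (A y + U t)) hL hgc P he
  obtain ⟨hC2, hd1, hdd⟩ := curve_of_phase (g := fun t y => c t • (A y + U t)) hgc hγ
  refine ⟨fun s => (γ s).1, hC2, by simp [h0], by rw [hd1]; simp [h0],
    fun t => by rw [hd1]; exact hunit t, fun t => ?_⟩
  have h := hdd t
  rw [hd1] at h
  rw [iteratedDeriv_succ, iteratedDeriv_one, hd1, h, map_smul, crossCLM_apply]

open CutoffShooting in
/-- **The cut-off local-induction equation on `ℝ³` with CONTINUOUS coefficients (uniqueness).** [folklore] -/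
theorem cutoffLia_unique_cont {c : ℝ → ℝ} {U : ℝ → EuclideanSpace ℝ (Fin 3)} (hc : Continuous c) (hU : Continuous U)
    (A : EuclideanSpace ℝ (Fin 3) →L[ℝ] EuclideanSpace ℝ (Fin 3))
    {X Y : ℝ → EuclideanSpace ℝ (Fin 3)} (hX : ContDiff ℝ 2 X) (hY : ContDiff ℝ 2 Y)
    (h0 : X 0 = Y 0) (h0' : deriv X 0 = deriv Y 0)
    (hXo : ∀ t, iteratedDeriv 2 X t = c t • cross (deriv X t) (A (X t) + U t))
    (hYo : ∀ t, iteratedDeriv 2 Y t = c t • cross (deriv Y t) (A (Y t) + U t)) : X = Y := by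
  have h2 : ∀ Z : ℝ → EuclideanSpace ℝ (Fin 3), iteratedDeriv 2 Z = deriv (deriv Z) :=
    fun Z => by rw [iteratedDeriv_succ, iteratedDeriv_one]
  have hL := lipschitz_affine_field crossCLM A hc hU
  refine unique_of_phase_of_lip (B := crossCLM) (g := fun t y => c t • (A y + U t)) hL hX hY h0 h0'
    (fun t => ?_) (fun t => ?_)
  · rw [← h2, hXo t, map_smul, crossCLM_apply]
  · rw [← h2, hYo t, map_smul, crossCLM_apply]

end SelectionBoxRJRung

end Summit.NavierStokesRegularity.NavierStokesRegularity.Theorems
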